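import Summits.ResolutionOfSingularities.ResolutionOfSingularities.Theorems.PurelyInseparableDim4JointChild
import Summits.ResolutionOfSingularities.ResolutionOfSingularities.Theorems.PurelyInseparableDim4ChartGrouping
import HarnessLib

/-!
# Purely inseparable four-folds: the STEP of the monotone joint forest — blowing up a coordinate member with a PLAN:
# its children (coordinate members) and leaves (point members) on the new stage (brick S3 (c) «joint point∘coordinate
# chains», part 12 = stage (C1) of the tree's v2, cell `res-dim4-pi`; consumes typ-2 g3's 3a–3b⁺⁺ and GROUPING/G1)

[OURS · counted 0] (D-0157 DOOR 2; desk WORD #66 (4)(c), #74 (g); frame `PIDim4.TerminationImpliesOrderReduction`,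
S3 (c); host item stmt-ResolutionOfSingularities-16155, helper). Nothing here proves resolution of singularities in
dimension ≥ 4 / characteristic `p` — NOT here, not anywhere in this programme.

A coordinate member `c` of `(Z, M)` (zigzag chart `Z ←φ— Y —ψ→ 𝔸⁵`, centre `Zc` reading `𝓘Λ S`, state `s`,
translated shape `(idx, cst)`) is blown up: `π : W → Z` ANY blowing up along `Zc`. A PLAN at `(s, S)` is a finite set of
ENTRIES `e = (j, b, S″)` (`j ∈ S`, `b_j = 0`, `S ⊆ S″`, `(j, b)` equimultiple, `S″` permissible for the child state
`step p S j b s`), pairwise SEPARATED (same chart: `bᵢ ≠ b′ᵢ` for some `i ∈ S″ ∩ S‴`; different charts `j ≠ j′`: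
`b′_j = 0 ∧ j ∈ S‴` or symmetrically), and a finite set of LEAVES `(j′, b′)` (equimultiple pairs) separated from
the entries (same chart: disagreement on `S″`; other chart `j`: `b′_j = 0`), such that every equimultiple pair
AGREES with an entry of its chart on `S″` or is a leaf (COVER). This file builds the new stage over `c`, all through
ONE comparison isomorphism `ε : π⁻¹φ(Y) ≅ B⁻¹ψ(Y)` (typ-2 g3):

* `leaf_model_point` — for a closed order-`p` point `w` over `c`: its model image `w₀ = ι(ε w)` is closed, lies
  over `V(z, x_S)`, and is `chartImm_{j′} (a′, b′)` with `(j′, b′)` equimultiple (S3 (b) «POINTS» on the model);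
* `leaf_chart` — `w` carries a zigzag chart reading `(z^p + (step p S j′ b′ s).F)·𝒪`, built from a re-centred model
  chart `φ₀ = Spec Θ′ ≫ chartImm_{j′}` with `φ₀ ξ = w₀` (part 1's `specMap_ξ_eq_of_reading`);
* `mem_image_zigzag_chart_iff` — points of `φ″(ψ″⁻¹ T)` for typ-2's chart of the chart: `w ∈ φ″(ψ″⁻¹T) ⟺ ι(ε w) ∈ φ₀(T)`;
* **`kid_package_of_iso`** — for an entry `(j, b, S″)`: the CHILD `c″ ⊆ W` with the coordinate-member data of part 10
  (regular, FC-1 re-derived, zigzag chart reading the child state and `𝓘Λ S″`, ranges, propagated shape) AND its MODEL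
  DESCRIPTION `w ∈ c″ ⟺ ι(ε w) ∈ T_B(j, b, S″)`, `c″ ⊆ π⁻¹(parent)`, `c″ ≠ ∅` — so that typ-2's GROUPING criteria
  (`disjoint_image_CΛ_chart_of_ne` / `…_of_ne_chart`, `chartImm_mem_image_CΛ_chart_iff`,
  `mem_image_CΛ_chart_of_agree`) on the model decide disjointness and membership in `W`.

The assembled step (children pairwise disjoint, cover by children and leaves) and the forest induction are part 13. AI-produced formalisation, weaker than expert review.
bears_on: LADDER-RESOLUTION:D157-DOOR2 (res-dim4-pi · S3 (c) joint v2 (C1)).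
-/

set_option linter.dupNamespace false -- D-0017: single-problem summit path `Summit.<S>.<S>.…` by design

noncomputable section

open MvPolynomial Finset CategoryTheory AlgebraicGeometry Opposite TopologicalSpace
open AlgebraicGeometry.Scheme.IdealSheafData (ofIdealTop vanishingIdeal)

namespace Summit.ResolutionOfSingularities.ResolutionOfSingularities.Theorems.PIDim4

open Literature.AlgebraicGeometry.Resolution
open Literature.AlgebraicGeometry.Resolution.Hauser2010
open Literature.AlgebraicGeometry.Resolution.AffinePointBlowup (P A γ coord Wtop ξ)

namespace Equimultiple

section ForestStep

variable {K : Type} [Field K] {p : ℕ} [hp : Fact p.Prime] [CharP K p] [DecidableEq K]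
variable {Z Y W Bl : Scheme.{0}} (φ : Y ⟶ Z) [IsOpenImmersion φ] (ψ : Y ⟶ P 4 K) [IsOpenImmersion ψ]
  {π : W ⟶ Z} {B : Bl ⟶ P 4 K} {S : Finset (Fin 4)}
  (ε : (π ⁻¹ᵁ φ.opensRange : Scheme.{0}) ≅ (B ⁻¹ᵁ ψ.opensRange : Scheme.{0}))

omit [DecidableEq K] in
/-- **THE MODEL IMAGE OF A POINT OVER THE MEMBER** (through the shared `ε`): for a CLOSED `w ∈ W` over
`φ(ψ⁻¹V(z, x_S))` with `ord_w (M.transform π Zc) ≥ p`, the point `w₀ = ι(ε w)` of the model is closed, lies over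
`V(z, x_S)`, has order `≥ p` for the model transform, hence is `chartImm_{j′} (a′, b′)` with `j′ ∈ S`, `b′_{j′} = 0`,
`a′^p + F′_{j′}(b′) = 0` and `(j′, b′)` equimultiple. [cite: Hauser2010, §F (equiconstant points)]
[cite: GortzWedhorn2020, Prop. 13.91] -/
theorem leaf_model_point [IsAlgClosed K] (Zc : Z.IdealSheafData)
    (hB : IsBlowup B (AffineCoordBlowup.𝓘Λ 4 K (insert 0 (Fin.succ '' (S : Set (Fin 4))))))
    (hsq : ε.hom ≫ (B ∣_ ψ.opensRange) = (π ∣_ φ.opensRange) ≫ (φ.isoOpensRange.inv ≫ ψ.isoOpensRange.hom))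
    (M : MarkedIdeal Z) (hmult : M.mult = p) (s : State K)
    (hKEY : ((controlledTransform B (AffineCoordBlowup.𝓘Λ 4 K (insert 0 (Fin.succ '' (S : Set (Fin 4)))))
        (hypSheaf p s.F) p).comap (B ⁻¹ᵁ ψ.opensRange).ι).comap ε.hom =
      (controlledTransform π Zc M.ideal p).comap (π ⁻¹ᵁ φ.opensRange).ι)
    (hperm : (p : ℕ∞) ≤ CentreBlowup.ordAlong S s.F) {w : W} (hw : IsClosed ({w} : Set W))
    (hwx : π w ∈ φ '' (ψ ⁻¹' (AffineCoordBlowup.CΛ 4 K (insert 0 (Fin.succ '' (S : Set (Fin 4)))) : Set (P 4 K))))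
    (hord : (p : ℕ∞) ≤ idealOrder (M.transform π Zc).ideal w) :
    ∃ (hwV : w ∈ π ⁻¹ᵁ φ.opensRange) (j : Fin 4) (hj : j ∈ S) (x : P 4 K) (a : K) (b : Fin 4 → K),
      AffineCoordBlowup.chartImm hB (ChartDictionary.succ_mem_centreVars hj) x =
          (B ⁻¹ᵁ ψ.opensRange).ι (ε.hom ⟨w, hwV⟩) ∧
        x.asIdeal = MvPolynomial.vanishingIdeal K {(Fin.cons a b : Fin (4 + 1) → K)} ∧
          a ^ p + MvPolynomial.eval b (CentreBlowup.chartTransform p S j s.F) = 0 ∧ b j = 0 ∧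
            CentreBlowup.IsEquimultiplePoint p S j b s := by
  haveI : IsProper B := hB.isProper
  haveI : IsLocallyNoetherian Bl := LocallyOfFiniteType.isLocallyNoetherian B
  haveI : JacobsonSpace Bl := jacobsonSpace_of_isBlowup' hB
  have he₁ι : φ.isoOpensRange.hom ≫ φ.opensRange.ι = φ := Scheme.Hom.isoOpensRange_hom_ι φ
  have he₂ι : ψ.isoOpensRange.hom ≫ ψ.opensRange.ι = ψ := Scheme.Hom.isoOpensRange_hom_ι ψ
  have hwV : w ∈ π ⁻¹ᵁ φ.opensRange := by
    obtain ⟨y, -, hy⟩ := hwx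
    exact ⟨y, hy⟩
  set wt : (π ⁻¹ᵁ φ.opensRange : Scheme.{0}) := ⟨w, hwV⟩ with hwt
  set w₀ : Bl := (B ⁻¹ᵁ ψ.opensRange).ι (ε.hom wt) with hw₀
  have hw₀_closed : IsClosed ({w₀} : Set Bl) := by
    have hwt_closed : IsClosed ({wt} : Set (π ⁻¹ᵁ φ.opensRange : Scheme.{0})) :=
      isClosed_singleton_of_isOpenImmersion_eq (π ⁻¹ᵁ φ.opensRange).ι wt hw rfl
    have hz_closed : IsClosed ({ε.hom wt} : Set (B ⁻¹ᵁ ψ.opensRange : Scheme.{0})) := by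
      have h : (ε.inv : (B ⁻¹ᵁ ψ.opensRange : Scheme.{0}) → (π ⁻¹ᵁ φ.opensRange : Scheme.{0})) ⁻¹' {wt} =
          {ε.hom wt} := by
        ext z'
        simp only [Set.mem_preimage, Set.mem_singleton_iff]
        constructor
        · intro hz'
          rw [← hz', ← Scheme.Hom.comp_apply, Iso.inv_hom_id]
          rfl
        · intro hz'
          rw [hz', ← Scheme.Hom.comp_apply, Iso.hom_inv_id]
          rfl
      rw [← h]
      exact hwt_closed.preimage ε.inv.continuous
    apply isClosed_singleton_of_isLocallyClosed_singleton
    rw [hw₀, ← Set.image_singleton]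
    exact hz_closed.isLocallyClosed.image (B ⁻¹ᵁ ψ.opensRange).ι.isOpenEmbedding.isInducing
      (B ⁻¹ᵁ ψ.opensRange).ι.isOpenEmbedding.isOpen_range.isLocallyClosed
  have hw₀C : B w₀ ∈ AffineCoordBlowup.CΛ 4 K (insert 0 (Fin.succ '' (S : Set (Fin 4)))) := by
    obtain ⟨q, hq, hqw⟩ := hwx
    have hφinv : φ.isoOpensRange.inv ((π ∣_ φ.opensRange) wt) = q := by
      have h1 : (π ∣_ φ.opensRange) wt = φ.isoOpensRange.hom q := by
        apply Subtype.ext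
        rw [morphismRestrict_base_coe]
        change π w = ((φ.isoOpensRange.hom ≫ φ.opensRange.ι) q : Z)
        rw [he₁ι, hqw]
      rw [h1, ← Scheme.Hom.comp_apply, Iso.hom_inv_id]
      rfl
    rw [hw₀, ← ι_morphismRestrict_apply, ← Scheme.Hom.comp_apply ε.hom (B ∣_ ψ.opensRange), hsq,
      Scheme.Hom.comp_apply, Scheme.Hom.comp_apply, hφinv, ← Scheme.Hom.comp_apply, he₂ι]
    exact hq
  have hord₀ : (p : ℕ∞) ≤ idealOrder (controlledTransform B
      (AffineCoordBlowup.𝓘Λ 4 K (insert 0 (Fin.succ '' (S : Set (Fin 4))))) (hypSheaf p s.F) p) w₀ := by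
    have hιwt : (π ⁻¹ᵁ φ.opensRange).ι wt = w := rfl
    have h := hord
    rw [MarkedIdeal.transform_ideal, hmult, ← hιwt, ← idealOrder_comap_of_isOpenImmersion (π ⁻¹ᵁ φ.opensRange).ι,
      ← hKEY, idealOrder_comap_of_isOpenImmersion ε.hom,
      idealOrder_comap_of_isOpenImmersion (B ⁻¹ᵁ ψ.opensRange).ι] at h
    rw [hw₀]
    exact h
  obtain ⟨j, hj, x, a, b, hxw, hx, hab, heq⟩ :=
    (le_idealOrder_controlledTransform_iff_exists_chart s hperm hB hw₀_closed).mp hord₀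
  have hbj : b j = 0 := by
    rw [← X_succ_mem_asIdeal_iff j a b hx, ← π_chartImm_mem_CΛ_iff hB hj x, hxw]
    exact hw₀C
  exact ⟨hwV, j, hj, x, a, b, hxw, hx, hab, hbj, heq⟩

/-- **THE LEAF CHART** (through the shared `ε`): in the setting of `leaf_model_point`, with `w₀ = chartImm_{j′} x`,
`x = (a′, b′)`, the point `w` carries a zigzag chart `W ←φ′— Y′ —ψ′→ 𝔸⁵` (`φ′ y′ = w`, `ψ′ y′ = ξ`) on which
`M.transform π Zc` reads `(z^p + (step p S j′ b′ s).F)·𝒪`, and `w₀ = φ₀ ξ` for the re-centred model chart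
`φ₀ = Spec Θ′ ≫ chartImm_{j′}` of typ-2's dictionary. [cite: BierstoneGrigorievMilmanWlodarczyk2011, §3.2] -/
theorem leaf_chart [IsAlgClosed K] (Zc : Z.IdealSheafData)
    (hB : IsBlowup B (AffineCoordBlowup.𝓘Λ 4 K (insert 0 (Fin.succ '' (S : Set (Fin 4))))))
    (M : MarkedIdeal Z) (hmult : M.mult = p) (s : State K)
    (hKEY : ((controlledTransform B (AffineCoordBlowup.𝓘Λ 4 K (insert 0 (Fin.succ '' (S : Set (Fin 4)))))
        (hypSheaf p s.F) p).comap (B ⁻¹ᵁ ψ.opensRange).ι).comap ε.hom =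
      (controlledTransform π Zc M.ideal p).comap (π ⁻¹ᵁ φ.opensRange).ι)
    (hperm : (p : ℕ∞) ≤ CentreBlowup.ordAlong S s.F) {w : W} (hwV : w ∈ π ⁻¹ᵁ φ.opensRange)
    {j : Fin 4} (hj : j ∈ S) {x : P 4 K} {a : K} {b : Fin 4 → K}
    (hxw : AffineCoordBlowup.chartImm hB (ChartDictionary.succ_mem_centreVars hj) x =
      (B ⁻¹ᵁ ψ.opensRange).ι (ε.hom ⟨w, hwV⟩))
    (hx : x.asIdeal = MvPolynomial.vanishingIdeal K {(Fin.cons a b : Fin (4 + 1) → K)})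
    (hab : a ^ p + MvPolynomial.eval b (CentreBlowup.chartTransform p S j s.F) = 0) (hbj : b j = 0) :
    ∃ (Θ : A 4 K ≃ₐ[K] A 4 K), (∀ i : Fin 4, Θ (X i.succ) = X i.succ + C (b i)) ∧
      (Spec.map (CommRingCat.ofHom (Θ : A 4 K →+* A 4 K)) ≫
        AffineCoordBlowup.chartImm hB (ChartDictionary.succ_mem_centreVars hj)) (ξ 4 K) =
        (B ⁻¹ᵁ ψ.opensRange).ι (ε.hom ⟨w, hwV⟩) ∧
      (controlledTransform B (AffineCoordBlowup.𝓘Λ 4 K (insert 0 (Fin.succ '' (S : Set (Fin 4))))) (hypSheaf p s.F) p).comap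
          (Spec.map (CommRingCat.ofHom (Θ : A 4 K →+* A 4 K)) ≫
            AffineCoordBlowup.chartImm hB (ChartDictionary.succ_mem_centreVars hj)) =
        hypSheaf p (CentreBlowup.step p S j b s).F ∧
      ∃ (Y' : Scheme.{0}) (φ' : Y' ⟶ W) (ψ' : Y' ⟶ P 4 K) (_ : IsOpenImmersion φ') (_ : IsOpenImmersion ψ')
        (y' : Y'), φ' y' = w ∧ ψ' y' = ξ 4 K ∧
        (M.transform π Zc).ideal.comap φ' = (hypSheaf p (CentreBlowup.step p S j b s).F).comap ψ' := by
  haveI : PerfectRing K p := PerfectRing.ofSurjective K p fun x => IsAlgClosed.exists_pow_nat_eq x hp.out.pos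
  obtain ⟨Θ, h, h0, hs, hc⟩ := ChartDictionary.controlledTransform_chart_eq_step p hj hbj s hperm hB
  haveI := isOpenImmersion_specMap_algEquiv Θ
  have hpt := specMap_ξ_eq_of_reading hB s hperm hj Θ h h0 hs hc hx hab
  set φ₀ : P 4 K ⟶ Bl := Spec.map (CommRingCat.ofHom (Θ : A 4 K →+* A 4 K)) ≫
    AffineCoordBlowup.chartImm hB (ChartDictionary.succ_mem_centreVars hj) with hφ₀
  have hφ₀ξ : φ₀ (ξ 4 K) = (B ⁻¹ᵁ ψ.opensRange).ι (ε.hom ⟨w, hwV⟩) := by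
    rw [hφ₀, Scheme.Hom.comp_apply, hpt, hxw]
  have hξY : ξ 4 K ∈ φ₀ ⁻¹ᵁ (B ⁻¹ᵁ ψ.opensRange) := by
    change φ₀ (ξ 4 K) ∈ B ⁻¹ᵁ ψ.opensRange
    rw [hφ₀ξ]
    exact (ε.hom ⟨w, hwV⟩).2
  refine ⟨Θ, hs, hφ₀ξ, hc, (φ₀ ⁻¹ᵁ (B ⁻¹ᵁ ψ.opensRange) : (P 4 K).Opens),
    (φ₀ ∣_ (B ⁻¹ᵁ ψ.opensRange)) ≫ ε.inv ≫ (π ⁻¹ᵁ φ.opensRange).ι, (φ₀ ⁻¹ᵁ (B ⁻¹ᵁ ψ.opensRange)).ι,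
    inferInstance, inferInstance, ⟨ξ 4 K, hξY⟩, ?_, rfl, ?_⟩
  · have h1 : (φ₀ ∣_ (B ⁻¹ᵁ ψ.opensRange)) ⟨ξ 4 K, hξY⟩ = ε.hom ⟨w, hwV⟩ := by
      apply Subtype.ext
      rw [morphismRestrict_base_coe]
      exact hφ₀ξ
    rw [Scheme.Hom.comp_apply, Scheme.Hom.comp_apply, h1, ← Scheme.Hom.comp_apply ε.hom ε.inv, Iso.hom_inv_id]
    rfl
  · rw [MarkedIdeal.transform_ideal, hmult, ChartDictionary.zigzag_transport_comap φ ψ ε φ₀ _ _ hKEY, hc]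

omit hp [CharP K p] [DecidableEq K] in
/-- **POINTS OF A CHILD THROUGH THE SHARED `ε`**: for typ-2's zigzag chart of the chart built from a model chart `φ₀`,
a point `w ∈ π⁻¹φ(Y)` lies in `φ″(ψ″⁻¹ T)` iff `ι(ε w) ∈ φ₀(T)`. [cite: GortzWedhorn2020, Prop. 13.91] -/
theorem mem_image_zigzag_chart_iff (φ₀ : P 4 K ⟶ Bl) (T : Set (P 4 K)) {w : W} (hwV : w ∈ π ⁻¹ᵁ φ.opensRange) :
    w ∈ ((φ₀ ∣_ (B ⁻¹ᵁ ψ.opensRange)) ≫ ε.inv ≫ (π ⁻¹ᵁ φ.opensRange).ι) ''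
        ((φ₀ ⁻¹ᵁ (B ⁻¹ᵁ ψ.opensRange)).ι ⁻¹' T) ↔
      ((B ⁻¹ᵁ ψ.opensRange).ι (ε.hom ⟨w, hwV⟩) : Bl) ∈ φ₀ '' T := by
  constructor
  · rintro ⟨y, hy, hyw⟩
    refine ⟨y.1, hy, ?_⟩
    have h1 : ε.hom ⟨w, hwV⟩ = (φ₀ ∣_ (B ⁻¹ᵁ ψ.opensRange)) y := by
      have h2 : (⟨w, hwV⟩ : (π ⁻¹ᵁ φ.opensRange : Scheme.{0})) = ε.inv ((φ₀ ∣_ (B ⁻¹ᵁ ψ.opensRange)) y) := by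
        apply Subtype.ext
        change w = ((π ⁻¹ᵁ φ.opensRange).ι (ε.inv ((φ₀ ∣_ (B ⁻¹ᵁ ψ.opensRange)) y)) : W)
        rw [← hyw, Scheme.Hom.comp_apply, Scheme.Hom.comp_apply]
      rw [h2, ← Scheme.Hom.comp_apply, Iso.inv_hom_id]
      rfl
    rw [h1, Scheme.Opens.ι_apply, morphismRestrict_base_coe]
  · rintro ⟨y, hy, hyw⟩
    have hyO : y ∈ φ₀ ⁻¹ᵁ (B ⁻¹ᵁ ψ.opensRange) := by
      change φ₀ y ∈ B ⁻¹ᵁ ψ.opensRange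
      rw [hyw]
      exact (ε.hom ⟨w, hwV⟩).2
    refine ⟨⟨y, hyO⟩, hy, ?_⟩
    have h1 : (φ₀ ∣_ (B ⁻¹ᵁ ψ.opensRange)) ⟨y, hyO⟩ = ε.hom ⟨w, hwV⟩ := by
      apply Subtype.ext
      rw [morphismRestrict_base_coe]
      exact hyw
    rw [Scheme.Hom.comp_apply, Scheme.Hom.comp_apply, h1, ← Scheme.Hom.comp_apply ε.hom ε.inv, Iso.hom_inv_id]
    rfl


/-- **THE CHILD THROUGH THE SHARED `ε`** (part 10's `coord_child_package` with the comparison isomorphism and the model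
chart made explicit, plus the MODEL DESCRIPTION of its points): for a plan entry `(j, b, S″)` (`j ∈ S`, `b_j = 0`,
`S ⊆ S″`) there are a closed `c″ ⊆ W` and a re-centring `Θ` at `b` reading the model transform as
`(z^p + (step p S j b s).F)·𝒪`, such that `w ∈ c″ ⟺ ι(ε w) ∈ T_B(j, b, S″) = (Spec Θ ≫ chartImm_j)(V(z, x_{S″}))` for
every `w` over the chart, `c″ ⊆ π⁻¹(parent)`, `c″ ≠ ∅`, and `c″` carries the coordinate-member data (regular, FC-1,
zigzag chart reading the child state and `𝓘Λ S″`, ranges, propagated shape).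
[cite: BierstoneGrigorievMilmanWlodarczyk2011, Def. 3.1.3 (1)–(2), (4)] [cite: GortzWedhorn2020, Prop. 13.91] -/
theorem kid_package_of_iso [IsLocallyNoetherian Z] [IsAlgClosed K] (Zc : Z.IdealSheafData)
    (hπ : IsBlowup π Zc) (hB : IsBlowup B (AffineCoordBlowup.𝓘Λ 4 K (insert 0 (Fin.succ '' (S : Set (Fin 4))))))
    (hsq : ε.hom ≫ (B ∣_ ψ.opensRange) = (π ∣_ φ.opensRange) ≫ (φ.isoOpensRange.inv ≫ ψ.isoOpensRange.hom))
    (hC' : ((AffineCoordBlowup.𝓘Λ 4 K (insert 0 (Fin.succ '' (S : Set (Fin 4))))).comap ψ.opensRange.ι).comap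
        (φ.isoOpensRange.inv ≫ ψ.isoOpensRange.hom) = Zc.comap φ.opensRange.ι)
    (M : MarkedIdeal Z) (hmult : M.mult = p) (s : State K)
    (hKEY : ((controlledTransform B (AffineCoordBlowup.𝓘Λ 4 K (insert 0 (Fin.succ '' (S : Set (Fin 4)))))
        (hypSheaf p s.F) p).comap (B ⁻¹ᵁ ψ.opensRange).ι).comap ε.hom =
      (controlledTransform π Zc M.ideal p).comap (π ⁻¹ᵁ φ.opensRange).ι)
    (hperm : (p : ℕ∞) ≤ CentreBlowup.ordAlong S s.F)
    (hsee : (AffineCoordBlowup.CΛ 4 K (insert 0 (Fin.succ '' (S : Set (Fin 4)))) : Set (P 4 K)) ⊆ Set.range ψ)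
    (hT : IsClosed (φ '' (ψ ⁻¹' (AffineCoordBlowup.CΛ 4 K (insert 0 (Fin.succ '' (S : Set (Fin 4)))) : Set (P 4 K)))))
    (hsncZ : HasSNCWith M.boundary Zc) (idx : Z.IdealSheafData → Fin 4) (cst : Z.IdealSheafData → K)
    (hshape : ∀ D ∈ M.boundary,
      ((D.support : Set Z) ∩ φ '' (ψ ⁻¹'
        (AffineCoordBlowup.CΛ 4 K (insert 0 (Fin.succ '' (S : Set (Fin 4)))) : Set (P 4 K)))).Nonempty →
      D.comap φ = (ofIdealTop (Ideal.span {(γ 4 K).symm (X (idx D).succ + C (cst D))})).comap ψ ∧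
        (idx D ∈ S → cst D = 0))
    (hinj : ∀ D₁ ∈ M.boundary, ∀ D₂ ∈ M.boundary,
      ((D₁.support : Set Z) ∩ φ '' (ψ ⁻¹'
        (AffineCoordBlowup.CΛ 4 K (insert 0 (Fin.succ '' (S : Set (Fin 4)))) : Set (P 4 K)))).Nonempty →
      ((D₂.support : Set Z) ∩ φ '' (ψ ⁻¹'
        (AffineCoordBlowup.CΛ 4 K (insert 0 (Fin.succ '' (S : Set (Fin 4)))) : Set (P 4 K)))).Nonempty →
      idx D₁ = idx D₂ → D₁ = D₂)
    {j : Fin 4} (hj : j ∈ S) {b : Fin 4 → K} (hbj : b j = 0) {S'' : Finset (Fin 4)} (hsub : S ⊆ S'') :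
    ∃ (c'' : Closeds W) (Θ : A 4 K ≃ₐ[K] A 4 K),
      (∀ i : Fin 4, Θ (X i.succ) = X i.succ + C (b i)) ∧
      (controlledTransform B (AffineCoordBlowup.𝓘Λ 4 K (insert 0 (Fin.succ '' (S : Set (Fin 4))))) (hypSheaf p s.F) p).comap
          (Spec.map (CommRingCat.ofHom (Θ : A 4 K →+* A 4 K)) ≫
            AffineCoordBlowup.chartImm hB (ChartDictionary.succ_mem_centreVars hj)) =
        hypSheaf p (CentreBlowup.step p S j b s).F ∧
      (∀ (w : W) (hwV : w ∈ π ⁻¹ᵁ φ.opensRange), w ∈ (c'' : Set W) ↔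
        ((B ⁻¹ᵁ ψ.opensRange).ι (ε.hom ⟨w, hwV⟩) : Bl) ∈
          (Spec.map (CommRingCat.ofHom (Θ : A 4 K →+* A 4 K)) ≫
            AffineCoordBlowup.chartImm hB (ChartDictionary.succ_mem_centreVars hj)) ''
            (AffineCoordBlowup.CΛ 4 K (insert 0 (Fin.succ '' (S'' : Set (Fin 4)))) : Set (P 4 K))) ∧
      (c'' : Set W) ⊆ π ⁻¹' (φ '' (ψ ⁻¹'
        (AffineCoordBlowup.CΛ 4 K (insert 0 (Fin.succ '' (S : Set (Fin 4)))) : Set (P 4 K)))) ∧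
      (c'' : Set W).Nonempty ∧
      Scheme.IsRegular (vanishingIdeal c'').subscheme ∧
      HasSNCWith (M.transform π Zc).boundary (vanishingIdeal c'') ∧
      ∃ (Y'' : Scheme.{0}) (φ'' : Y'' ⟶ W) (ψ'' : Y'' ⟶ P 4 K) (_ : IsOpenImmersion φ'') (_ : IsOpenImmersion ψ''),
        (M.transform π Zc).ideal.comap φ'' = (hypSheaf p (CentreBlowup.step p S j b s).F).comap ψ'' ∧
        (vanishingIdeal c'').comap φ'' =
          (AffineCoordBlowup.𝓘Λ 4 K (insert 0 (Fin.succ '' (S'' : Set (Fin 4))))).comap ψ'' ∧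
        (c'' : Set W) ⊆ Set.range φ'' ∧
        (AffineCoordBlowup.CΛ 4 K (insert 0 (Fin.succ '' (S'' : Set (Fin 4)))) : Set (P 4 K)) ⊆ Set.range ψ'' ∧
        ∃ (idx₂ : W.IdealSheafData → Fin 4) (cst₂ : W.IdealSheafData → K),
          (∀ D₂ ∈ (M.transform π Zc).boundary,
            ((D₂.support : Set W) ∩ φ'' '' (ψ'' ⁻¹'
              (AffineCoordBlowup.CΛ 4 K (insert 0 (Fin.succ '' (S'' : Set (Fin 4)))) : Set (P 4 K)))).Nonempty →
            D₂.comap φ'' = (ofIdealTop (Ideal.span {(γ 4 K).symm (X (idx₂ D₂).succ + C (cst₂ D₂))})).comap ψ'' ∧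
              (idx₂ D₂ ∈ S'' → cst₂ D₂ = 0)) ∧
          (∀ D₁ ∈ (M.transform π Zc).boundary, ∀ D₂ ∈ (M.transform π Zc).boundary,
            ((D₁.support : Set W) ∩ φ'' '' (ψ'' ⁻¹'
              (AffineCoordBlowup.CΛ 4 K (insert 0 (Fin.succ '' (S'' : Set (Fin 4)))) : Set (P 4 K)))).Nonempty →
            ((D₂.support : Set W) ∩ φ'' '' (ψ'' ⁻¹'
              (AffineCoordBlowup.CΛ 4 K (insert 0 (Fin.succ '' (S'' : Set (Fin 4)))) : Set (P 4 K)))).Nonempty →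
            idx₂ D₁ = idx₂ D₂ → D₁ = D₂) := by
  haveI : PerfectRing K p := PerfectRing.ofSurjective K p fun x => IsAlgClosed.exists_pow_nat_eq x hp.out.pos
  haveI : IsProper π := hπ.isProper
  haveI : IsLocallyNoetherian W := LocallyOfFiniteType.isLocallyNoetherian π
  haveI : IsProper B := hB.isProper
  haveI : IsLocallyNoetherian Bl := LocallyOfFiniteType.isLocallyNoetherian B
  have hK := hKEY
  obtain ⟨Θ, h, h0, hs, hc⟩ := ChartDictionary.controlledTransform_chart_eq_step p hj hbj s hperm hB
  haveI := isOpenImmersion_specMap_algEquiv Θ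
  obtain ⟨hread, -, hnext⟩ :=
    ChartDictionary.zigzag_chart_of_chart φ ψ M hmult s.F (CentreBlowup.step p S j b s).F Zc hsee hT hB ε hsq hC' hK
      hj hbj h0 hs hc
  obtain ⟨hsee'', hclosed''⟩ := hnext S'' hsub
  set φ₀ : P 4 K ⟶ Bl := Spec.map (CommRingCat.ofHom (Θ : A 4 K →+* A 4 K)) ≫
    AffineCoordBlowup.chartImm hB (ChartDictionary.succ_mem_centreVars hj) with hφ₀
  set φ'' := (φ₀ ∣_ (B ⁻¹ᵁ ψ.opensRange)) ≫ ε.inv ≫ (π ⁻¹ᵁ φ.opensRange).ι with hφ''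
  set ψ'' := (φ₀ ⁻¹ᵁ (B ⁻¹ᵁ ψ.opensRange)).ι with hψ''
  haveI : IsOpenImmersion φ₀ := by rw [hφ₀]; infer_instance
  haveI : IsOpenImmersion φ'' := by rw [hφ'']; infer_instance
  set c'' : Closeds W := closureImage φ'' ((((AffineCoordBlowup.𝓘Λ 4 K
    (insert 0 (Fin.succ '' (S'' : Set (Fin 4))))).comap ψ'').support : Set (φ₀ ⁻¹ᵁ (B ⁻¹ᵁ ψ.opensRange)))) with hc''
  have hcoe : (c'' : Set W) = φ'' '' (ψ'' ⁻¹'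
      (AffineCoordBlowup.CΛ 4 K (insert 0 (Fin.succ '' (S'' : Set (Fin 4)))) : Set (P 4 K))) := by
    rw [hc'', coe_closureImage, ChartDictionary.coe_support_comap_𝓘Λ ψ'', hclosed''.closure_eq]
  obtain ⟨idx₂, cst₂, hshape₂, hinj₂⟩ :=
    ChartDictionary.shapeT_transform_zigzag φ ψ ε Zc hB hsq hC' hj hbj hs hsub idx cst hshape hinj
  have hE₂ : HasSNC (M.transform π Zc).boundary := MarkedIdeal.hasSNC_transform_boundary M hsncZ hπ
  have hEc₂ : HasSNCWith ((M.transform π Zc).boundary.map (·.comap φ''))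
      ((AffineCoordBlowup.𝓘Λ 4 K (insert 0 (Fin.succ '' (S'' : Set (Fin 4))))).comap ψ'') :=
    ChartDictionary.hasSNCWith_comap_of_shapeT_zigzag φ'' ψ'' hE₂ idx₂ cst₂ hshape₂ hinj₂
  -- non-emptiness: the origin of the chart lies on the child
  have hξ : (ξ 4 K) ∈ AffineCoordBlowup.CΛ 4 K (insert 0 (Fin.succ '' (S'' : Set (Fin 4)))) := by
    rw [AffineCoordBlowup.mem_CΛ_iff']
    intro i _
    exact (mem_originIdeal_iff K (4 + 1)).mpr (constantCoeff_X K i)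
  obtain ⟨y₀, hy₀⟩ := hsee'' hξ
  refine ⟨c'', Θ, hs, hc, fun w hwV => ?_, ?_, ⟨φ'' y₀, ?_⟩,
    ChartDictionary.isRegular_globalCentre_zigzag φ'' ψ'' hclosed'',
    ChartDictionary.hasSNCWith_globalCentre_zigzag φ'' ψ'' hclosed'' hE₂ hEc₂, _, φ'', ψ'', inferInstance,
    inferInstance, hread, by rw [hc'']; exact ChartDictionary.comap_globalCentre_zigzag φ'' ψ'' _,
    by rw [hcoe]; exact Set.image_subset_range _ _, hsee'', idx₂, cst₂, hshape₂, hinj₂⟩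
  · rw [hcoe]
    exact mem_image_zigzag_chart_iff φ ψ ε φ₀ _ hwV
  · rw [hcoe]
    exact ChartDictionary.image_next_centre_subset_preimage_zigzag φ ψ ε hB hsq hj hbj hs hsub
  · rw [hcoe]
    exact ⟨y₀, by rw [Set.mem_preimage, hy₀]; exact hξ, rfl⟩

end ForestStep

end Equimultiple

end Summit.ResolutionOfSingularities.ResolutionOfSingularities.Theorems.PIDim4

end
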